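import Literature.NumberTheory.Automorphic.CuspidalWhittakerGL2
import Literature.NumberTheory.Automorphic.RankinSelbergTorusPointwise
import Literature.NumberTheory.Automorphic.CuspidalContragredientInvolution
import Literature.NumberTheory.Automorphic.IwasawaHaarGL2KAN
import Literature.NumberTheory.Automorphic.WhittakerTowerCoeff
import HarnessLib

/-!
# The Whittaker coefficient of `φ ∘ ι` on `GL₂`: `W^ψ_{φ∘ι}(g) = W^ψ_φ(ε w ᵗg⁻¹)`
# (Jacquet–Langlands (1970), proof of Thm. 11.1, p. 231: `Ψ̃(g, s, W) = Ψ(w ᵗg⁻¹ …)`; Cogdell (2004), §2.3)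

Topic `NumberTheory/Automorphic`; namespace `Literature.NumberTheory.Automorphic`. Theorems only (no
definition, no named fact, no instance). For a left `GL₂(K)`-invariant function `φ` on `GL₂(𝔸_K)` and
the transpose-inverse automorphism `ι(g) = ᵗg⁻¹` (`GaloisRepresentations.glTransposeInv`), the global
`ψ`-Whittaker coefficient of `φ ∘ ι` is the `ψ`-Whittaker coefficient of `φ` at the point
`ε w ι(g)`, `w = weylLong 2` the long Weyl element and `ε = diag(-1, 1)`:

* `glTransposeInv_coe_adelicUnipotent_two` — `ι(u) = w u⁻¹ w` for `u ∈ N₂(𝔸_K)`;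
* `whittakerCharFun_inv_eq_mulShift_neg_one` — `ψ_N(u⁻¹) = (ψ(-·))_N(u)`;
* `map_weylLong`, `weylLong_mem_arithmeticSubgroup` — `w` is rational;
* `whittakerCoeff_comp_glTransposeInv_two` (**main**) —

    `whittakerCoeff ν 𝓕_N ψ (φ ∘ ι) g = whittakerCoeff ν 𝓕_N ψ φ (ε * (w * ι g))`

  for every Haar measure `ν` on `N₂(𝔸_K)`, `𝓕_N` Tate's box and `ψ = adeleAddChar K`: substitute
  `u ↦ u⁻¹` in `∫_{N(K)\N(𝔸)} φ(ι(u g)) ψ̄(u) du` (`ι(u) = w u⁻¹ w`, `φ(w ·) = φ`, the Haar measure of the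
  abelian `N₂(𝔸_K)` is inversion invariant, `𝓕_N⁻¹` is again a fundamental domain), which turns `ψ` into
  `ψ(-·)`, and move the dilation `-1` of the character to the argument (`whittakerCoeff_mulShift`);
* `whittakerCoeff_comp_glTransposeInv_glDiagonal_two` — at `g = diag(a, 1)`:
  `W^ψ_{φ∘ι}(diag(a,1)) = W^ψ_φ(w ι(diag(-a,1))) = W̃^ψ_φ(diag(-a,1))` (`tildeFn`), the rational central
  sign `-1 = ε w ι(diag(a,1)) (w ι(diag(-a,1)))⁻¹` being invisible to `W^ψ_φ`
  (`whittakerCoeff_center_mul`);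
* `whittakerDepth_zero_comp_glTransposeInv_glDiagonal_two` — the same for the Tate-normalised transform
  `whittakerDepth 0` of a continuous `φ`.

This is the identity behind the dual side of the global Hecke integral: the unfolded integral of
`φ ∘ ι` is `∫_{𝕀_K} W̃_φ(diag(a,1)) |a|^{s-1/2} d×a` after `a ↦ -a`.

## References

* H. Jacquet, R. P. Langlands, *Automorphic Forms on GL(2)*, LNM 114 (1970), Thm. 11.1, proof pp. 230–231
  [JacquetLanglands1970].
* J. W. Cogdell, *Lectures on L-functions, converse theorems, and functoriality for GL_n* (2004), §2.3,
  Thm. 2.1 [CogdellAnalyticTheory2004].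
-/

noncomputable section

open MeasureTheory Measure NumberField IsDedekindDomain Matrix Set
open Literature.NumberTheory.GaloisRepresentations (ideleGroup glTransposeInv coe_glTransposeInv_apply principalIdele)
open scoped MatrixGroups ComplexConjugate

namespace Literature.NumberTheory.Automorphic

/-! ### 1. Matrix identities on `GL₂` -/

section Matrices

variable {R S : Type*} [CommRing R] [CommRing S]

/-- **`w` is a matrix of `0`s and `1`s**: the long Weyl element commutes with entrywise ring maps. [folklore] -/
theorem map_weylLong {n : ℕ} (f : R →+* S) :
    Matrix.GeneralLinearGroup.map f (weylLong n R) = weylLong n S := by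
  refine Matrix.GeneralLinearGroup.ext fun i j => ?_
  rw [Matrix.GeneralLinearGroup.map_apply, coe_weylLong, coe_weylLong, Equiv.Perm.permMatrix,
    Equiv.Perm.permMatrix, PEquiv.toMatrix_apply, PEquiv.toMatrix_apply]
  split_ifs <;> simp

/-- **`ι(u) = w u⁻¹ w` on `N₂`**: the transpose-inverse of an upper unipotent `2 × 2` matrix is the
conjugate of its inverse by the long Weyl element. [folklore] -/
theorem glTransposeInv_coe_upperUnitriangular_two [TopologicalSpace R] (u : ↥(upperUnitriangular (Fin 2) R)) :
    glTransposeInv (Fin 2) R (u : GL (Fin 2) R) =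
      weylLong 2 R * ((u⁻¹ : ↥(upperUnitriangular (Fin 2) R)) : GL (Fin 2) R) * weylLong 2 R := by
  -- write `u = n(x)`, `u⁻¹ = n(-x)`
  set x : R := ((u : GL (Fin 2) R) : Matrix (Fin 2) (Fin 2) R) 0 1 with hx
  have hu : u = unipotentGL2 x := (unipotentGL2_entry u).symm
  have hui : u⁻¹ = unipotentGL2 (-x) := by
    rw [hu, eq_comm, eq_inv_iff_mul_eq_one, ← unipotentGL2_add, neg_add_cancel, unipotentGL2_zero]
  refine Matrix.GeneralLinearGroup.ext fun i j => ?_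
  rw [coe_glTransposeInv_apply, Units.val_mul, Units.val_mul, weylLong_mul_mul_weylLong_apply, Matrix.transpose_apply,
    show (((u : GL (Fin 2) R)⁻¹ : GL (Fin 2) R) : Matrix (Fin 2) (Fin 2) R) =
      (((u⁻¹ : ↥(upperUnitriangular (Fin 2) R)) : GL (Fin 2) R) : Matrix (Fin 2) (Fin 2) R) from rfl,
    hui, coe_unipotentGL2]
  fin_cases i <;> fin_cases j <;> rfl

end Matrices

/-! ### 2. The generic character under inversion -/

section Character

variable {R : Type*} [CommRing R] {n : ℕ}

/-- **`ψ_N(u⁻¹) = (ψ(-·))_N(u)`**: inverting the unipotent argument dilates the character by `-1`. [folklore] -/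
theorem whittakerCharFun_inv_eq_mulShift_neg_one (ψ : AddChar R Circle) (u : ↥(upperUnitriangular (Fin n) R)) :
    whittakerCharFun ψ u⁻¹ = whittakerCharFun (ψ.mulShift (-1)) u := by
  have h1 : whittakerCharFun ψ u * whittakerCharFun ψ u⁻¹ = 1 := by
    rw [← whittakerCharFun_mul, mul_inv_cancel, whittakerCharFun_one]
  have h2 : whittakerCharFun ψ u⁻¹ = (whittakerCharFun ψ u)⁻¹ :=
    eq_inv_of_mul_eq_one_right h1
  rw [h2, whittakerCharFun_apply, whittakerCharFun_apply, AddChar.mulShift_apply, neg_one_mul,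
    AddChar.map_neg_eq_inv, Circle.coe_inv]

end Character

/-! ### 3. The Whittaker coefficient of `φ ∘ ι` -/

section Main

variable {K : Type} [Field K] [NumberField K]

local notation "𝔸" => AdeleRing (𝓞 K) K

/-- The long Weyl element of `GL_n(𝔸_K)` is rational. [folklore] -/
theorem weylLong_mem_arithmeticSubgroup (n : ℕ) :
    (weylLong n 𝔸 : GL (Fin n) 𝔸) ∈ (AdelicGroupData.gl n K).arithmeticSubgroup := by
  rw [← rationalPointsGL_eq_arithmeticSubgroup]
  exact ⟨weylLong n K, map_weylLong (algebraMap K 𝔸)⟩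

variable [MeasurableSpace ↥(adelicUnipotent 2 K)] [BorelSpace ↥(adelicUnipotent 2 K)]

/-- **MAIN. `W^ψ_{φ∘ι}(g) = W^ψ_φ(ε w ι(g))` on `GL₂`.** For a left `GL₂(K)`-invariant `φ` on `GL₂(𝔸_K)`,
a Haar measure `ν` on `N₂(𝔸_K)`, Tate's box `𝓕_N` and the standard character `ψ`:

  `whittakerCoeff ν 𝓕_N ψ (φ ∘ ι) g = whittakerCoeff ν 𝓕_N ψ φ (ε * (w * ι g))`,

`ι = glTransposeInv`, `w = weylLong 2`, `ε = diag(-1, 1)` (the matrix `d_{-1}` of `whittakerCoeff_mulShift`).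
[cite: JacquetLanglands1970, Thm. 11.1, proof p. 231] [cite: CogdellAnalyticTheory2004, §2.3] -/
theorem whittakerCoeff_comp_glTransposeInv_two (ν : Measure ↥(adelicUnipotent 2 K)) [IsHaarMeasure ν]
    {φ : GL (Fin 2) 𝔸 → ℂ} (hφ : IsLeftInvariant (AdelicGroupData.gl 2 K) φ) (g : GL (Fin 2) 𝔸) :
    whittakerCoeff ν (unipotentTateDomain 2 K) (adeleAddChar K) (φ ∘ glTransposeInv (Fin 2) 𝔸) g =
      whittakerCoeff ν (unipotentTateDomain 2 K) (adeleAddChar K) φ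
        (glDiagonal 2 𝔸 (fun i : Fin 2 => principalIdele K ((-1 : Kˣ) ^ (2 - 1 - (i : ℕ)))) *
          ((weylLong 2 𝔸 : GL (Fin 2) 𝔸) * glTransposeInv (Fin 2) 𝔸 g)) := by
  borelize (AdeleRing (𝓞 K) K)
  -- instances on the abelian group `N₂(𝔸_K)`
  haveI : T2Space (GL (Fin 2) 𝔸) := t2Space_gl 2 K
  haveI : LocallyCompactSpace (GL (Fin 2) 𝔸) := AdelicGroupData.locallyCompactSpace_generalLinearGroup_adeleRing K (Fin 2)
  haveI : SecondCountableTopology (GL (Fin 2) 𝔸) := secondCountableTopology_generalLinearGroup_adeleRing K (Fin 2)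
  haveI : SecondCountableTopology ↥(adelicUnipotent 2 K) := TopologicalSpace.Subtype.secondCountableTopology _
  haveI : LocallyCompactSpace ↥(adelicUnipotent 2 K) := (isClosed_adelicUnipotent 2 K).locallyCompactSpace
  haveI : ν.IsMulRightInvariant := isMulRightInvariant_of_upperUnitriangular_two ν
  haveI : ν.IsInvInvariant := isInvInvariant_of_isMulRightInvariant ν
  have hψ : IsGlobalAddChar K (adeleAddChar K) := isGlobalAddChar_adeleAddChar (K := K)
  have hψ' : IsGlobalAddChar K ((adeleAddChar K).mulShift (algebraMap K 𝔸 ((-1 : Kˣ) : K))) :=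
    hψ.mulShift (by rw [Units.val_neg, Units.val_one]; exact neg_ne_zero.2 one_ne_zero)
  have h𝓕 := isFundamentalDomain_unipotentTateDomain (n := 2) (K := K) ν
  have h𝓕' := isFundamentalDomain_inv_unipotentTateDomain (K := K) ν
  have hwrat : (weylLong 2 𝔸 : GL (Fin 2) 𝔸) ∈ (AdelicGroupData.gl 2 K).arithmeticSubgroup :=
    weylLong_mem_arithmeticSubgroup 2
  -- Step 1: `φ(ι(u g)) = φ(u⁻¹ h)`, `h = w ι(g)`
  have hpt : ∀ u : ↥(adelicUnipotent 2 K),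
      (φ ∘ glTransposeInv (Fin 2) 𝔸) ((u : GL (Fin 2) 𝔸) * g) =
        φ (((u⁻¹ : ↥(adelicUnipotent 2 K)) : GL (Fin 2) 𝔸) *
          ((weylLong 2 𝔸 : GL (Fin 2) 𝔸) * glTransposeInv (Fin 2) 𝔸 g)) := by
    intro u
    rw [Function.comp_apply, map_mul, glTransposeInv_coe_upperUnitriangular_two, mul_assoc, mul_assoc]
    exact hφ _ hwrat _
  -- Step 2: move the dilation `-1` to the argument, then change the fundamental domain to `𝓕⁻¹`
  rw [← whittakerCoeff_mulShift ν h𝓕 hψ hφ (-1 : Kˣ),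
    whittakerCoeff_eq_of_isFundamentalDomain h𝓕 h𝓕' hψ' hφ]
  -- Step 3: the substitution `u ↦ u⁻¹`
  simp only [whittakerCoeff_def]
  rw [measure_inv]
  congr 1
  have hme : MeasurableEmbedding (fun u : ↥(adelicUnipotent 2 K) => u⁻¹) :=
    (MeasurableEquiv.inv ↥(adelicUnipotent 2 K)).measurableEmbedding
  have key := hme.setIntegral_map (μ := ν)
    (fun u : ↥(adelicUnipotent 2 K) => φ ((u : GL (Fin 2) 𝔸) *
        ((weylLong 2 𝔸 : GL (Fin 2) 𝔸) * glTransposeInv (Fin 2) 𝔸 g)) *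
      conj (whittakerCharFun ((adeleAddChar K).mulShift (algebraMap K 𝔸 ((-1 : Kˣ) : K))) u))
    ((unipotentTateDomain 2 K)⁻¹)
  rw [map_inv_eq_self] at key
  rw [key, show (fun u : ↥(adelicUnipotent 2 K) => u⁻¹) ⁻¹' (unipotentTateDomain 2 K)⁻¹ = unipotentTateDomain 2 K by
    ext u; simp]
  refine setIntegral_congr_fun measurableSet_unipotentTateDomain fun u _ => ?_
  simp only [hpt u, Subgroup.coe_inv]
  congr 1
  rw [show algebraMap K 𝔸 ((-1 : Kˣ) : K) = -1 by rw [Units.val_neg, Units.val_one, map_neg, map_one],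
    ← whittakerCharFun_inv_eq_mulShift_neg_one, inv_inv]

omit [MeasurableSpace ↥(adelicUnipotent 2 K)] [BorelSpace ↥(adelicUnipotent 2 K)] in
/-- The product `ε w ι(diag(a, 1))` is the rational central `-1` times `w ι(diag(-a, 1))`. [folklore] -/
theorem diag_mul_weylLong_mul_glTransposeInv_glDiagonal (a : ideleGroup K) :
    glDiagonal 2 𝔸 (fun i : Fin 2 => principalIdele K ((-1 : Kˣ) ^ (2 - 1 - (i : ℕ)))) *
        ((weylLong 2 𝔸 : GL (Fin 2) 𝔸) * glTransposeInv (Fin 2) 𝔸 (glDiagonal 2 𝔸 ![a, 1])) =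
      glDiagonal 2 𝔸 (fun _ : Fin 2 => principalIdele K (-1 : Kˣ)) *
        ((weylLong 2 𝔸 : GL (Fin 2) 𝔸) * glTransposeInv (Fin 2) 𝔸 (glDiagonal 2 𝔸 ![-a, 1])) := by
  -- `w ι(diag(d)) = diag(rev d⁻¹) w`
  have hτ : ∀ d : Fin 2 → ideleGroup K,
      (weylLong 2 𝔸 : GL (Fin 2) 𝔸) * glTransposeInv (Fin 2) 𝔸 (glDiagonal 2 𝔸 d) =
        glDiagonal 2 𝔸 (fun k => (d k.rev)⁻¹) * weylLong 2 𝔸 := by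
    intro d
    have h := weylLong_mul_glTransposeInv_mul_weylLong_glDiagonal (n := 2) (R := 𝔸) d
    calc (weylLong 2 𝔸 : GL (Fin 2) 𝔸) * glTransposeInv (Fin 2) 𝔸 (glDiagonal 2 𝔸 d)
        = weylLong 2 𝔸 * glTransposeInv (Fin 2) 𝔸 (glDiagonal 2 𝔸 d) * weylLong 2 𝔸 * (weylLong 2 𝔸)⁻¹ := by
          rw [mul_inv_cancel_right]
      _ = glDiagonal 2 𝔸 (fun k => (d k.rev)⁻¹) * weylLong 2 𝔸 := by rw [h, weylLong_inv]
  rw [hτ, hτ, ← mul_assoc, ← mul_assoc, ← map_mul, ← map_mul]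
  congr 2
  funext k
  have hneg : principalIdele K (-1 : Kˣ) = -1 := by
    refine Units.ext ?_
    change algebraMap K 𝔸 ((-1 : Kˣ) : K) = _
    rw [Units.val_neg, Units.val_one, map_neg, map_one, Units.val_neg, Units.val_one]
  have hinv : (-a)⁻¹ = -a⁻¹ := inv_eq_of_mul_eq_one_right (by rw [neg_mul_neg, mul_inv_cancel])
  fin_cases k
  · change principalIdele K ((-1 : Kˣ) ^ (2 - 1 - 0)) * (![a, 1] (Fin.rev 0))⁻¹ =
      principalIdele K (-1 : Kˣ) * (![-a, 1] (Fin.rev 0))⁻¹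
    rw [show (2 - 1 - 0 : ℕ) = 1 from rfl, pow_one, show Fin.rev (0 : Fin 2) = 1 from rfl, Matrix.cons_val_one,
      Matrix.cons_val_one]
  · change principalIdele K ((-1 : Kˣ) ^ (2 - 1 - 1)) * (![a, 1] (Fin.rev 1))⁻¹ =
      principalIdele K (-1 : Kˣ) * (![-a, 1] (Fin.rev 1))⁻¹
    rw [show (2 - 1 - 1 : ℕ) = 0 from rfl, pow_zero, map_one, one_mul, hneg,
      show Fin.rev (1 : Fin 2) = 0 from rfl, Matrix.cons_val_zero, Matrix.cons_val_zero, hinv, neg_mul_neg,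
      one_mul]

/-- **`W^ψ_{φ∘ι}(diag(a,1)) = W^ψ_φ(w ι(diag(-a,1))) = W̃^ψ_φ(diag(-a,1))`** for a left `GL₂(K)`-invariant `φ`:
the main identity at a torus point, the rational central sign being invisible to the Whittaker coefficient.
[cite: JacquetLanglands1970, Thm. 11.1, proof p. 231] -/
theorem whittakerCoeff_comp_glTransposeInv_glDiagonal_two (ν : Measure ↥(adelicUnipotent 2 K)) [IsHaarMeasure ν]
    {φ : GL (Fin 2) 𝔸 → ℂ} (hφ : IsLeftInvariant (AdelicGroupData.gl 2 K) φ) (a : ideleGroup K) :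
    whittakerCoeff ν (unipotentTateDomain 2 K) (adeleAddChar K) (φ ∘ glTransposeInv (Fin 2) 𝔸)
        (glDiagonal 2 𝔸 ![a, 1]) =
      tildeFn (whittakerCoeff ν (unipotentTateDomain 2 K) (adeleAddChar K) φ) (glDiagonal 2 𝔸 ![-a, 1]) := by
  rw [whittakerCoeff_comp_glTransposeInv_two ν hφ, diag_mul_weylLong_mul_glTransposeInv_glDiagonal,
    whittakerCoeff_glDiagonal_principalIdele_mul ν _ _ hφ, tildeFn_apply]

end Main

/-! ### 4. The Tate-normalised Whittaker transform -/

section Depth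

variable {K : Type} [Field K] [NumberField K]

local notation "𝔸" => AdeleRing (𝓞 K) K

variable [MeasurableSpace (GL (Fin 2) (AdeleRing (𝓞 K) K))] [BorelSpace (GL (Fin 2) (AdeleRing (𝓞 K) K))]

/-- **The Tate-normalised Whittaker transform of `φ ∘ ι` at torus points** (continuous, left-invariant `φ`):
`whittakerDepth 0 (φ ∘ ι) (diag(a,1)) = tildeFn (whittakerDepth 0 φ) (diag(-a,1))`.
[cite: JacquetLanglands1970, Thm. 11.1, proof p. 231] [cite: CogdellAnalyticTheory2004, §2.3] -/
theorem whittakerDepth_zero_comp_glTransposeInv_glDiagonal_two {φ : GL (Fin 2) 𝔸 → ℂ} (hφc : Continuous φ)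
    (hφ : IsLeftInvariant (AdelicGroupData.gl 2 K) φ) (a : ideleGroup K) :
    whittakerDepth 0 (φ ∘ glTransposeInv (Fin 2) 𝔸) (glDiagonal 2 𝔸 ![a, 1]) =
      tildeFn (whittakerDepth 0 φ) (glDiagonal 2 𝔸 ![-a, 1]) := by
  haveI : T2Space (GL (Fin 2) 𝔸) := t2Space_gl 2 K
  haveI : LocallyCompactSpace (GL (Fin 2) 𝔸) := AdelicGroupData.locallyCompactSpace_generalLinearGroup_adeleRing K (Fin 2)
  haveI : LocallyCompactSpace ↥(adelicUnipotent 2 K) := (isClosed_adelicUnipotent 2 K).locallyCompactSpace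
  haveI : BorelSpace ↥(adelicUnipotent 2 K) := Subtype.borelSpace _
  set ν : Measure ↥(adelicUnipotent 2 K) := Measure.haar with hν
  have hφιc : Continuous (φ ∘ glTransposeInv (Fin 2) 𝔸) := hφc.comp (glTransposeInv (Fin 2) 𝔸).continuous
  rw [whittakerDepth_zero_eq_whittakerCoeff hφιc (by norm_num) ν, tildeFn_apply,
    whittakerDepth_zero_eq_whittakerCoeff hφc (by norm_num) ν, ← tildeFn_apply (whittakerCoeff ν _ _ φ),
    whittakerCoeff_comp_glTransposeInv_glDiagonal_two ν hφ]

end Depth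

end Literature.NumberTheory.Automorphic
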